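/-
Copyright (c) 2026 the pub-hodgecm-mathlib formalisation cell (harness21).  Prover seat hodgecm-mathlib-LH4-p18 (g3), Track A «FOUR-FRAME» hand on VALVE loan to
Track B «K2-LIT», #184♮ = hLiu418 = `stmt-HodgeConjecture-24832`; socket #41, KIND 1 (K1-b♮ LINE TERM), organ (K1b-W) «KIND W AT `n := 1` FOR THE PULLED-BACK FAMILY»
— LEAD F0P6-plan (g14) BATCH #122 (3) (2026-09-04T23:08:21Z), line lead K2Liu-p14 (g4); file (KW1-g).
THEOREMS ONLY (no `def`, no `instance`, no notation, no named-fact hypothesis, no `sorry`).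
-/
import Summits.HodgeConjecture.HodgeConjecture.Theorems.K2LiuSiegelUnipotentCharacterFactorisation   -- ★ (d1) (K2Liu-p03∕p06): `exists_finset_forall_integral`; brings `unipDeltaLoc`, `inH`, `localInt`, `hermD`
import Summits.HodgeConjecture.HodgeConjecture.Theorems.K2E1HeckeCharBaseChangeLocalComponentsU      -- ★ J1a-dict (K2E1-p15): `valueAtUniformizer_eq_prod_of_comp_ideleBaseChange`
import Summits.HodgeConjecture.HodgeConjecture.Theorems.K2LiuLocalLFactorDefs                        -- ★ (K2Liu-p01): `unifAt`, `valued_unifAt`, `unifAt_ne_zero`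
import Literature.NumberTheory.GelbartRogawski1991.LocalDoubledUnitaryGoodPlace                      -- ★ `LocalSplitting.valuation_eq_one_iff_valued` (the two valuation spellings)
import Literature.NumberTheory.Automorphic.HeckeCharacterLocalComponentSmooth                        -- ★ `IsUnramifiedAt.localComponent_eq_one_of_valuation_eq_one`
import Literature.RepresentationTheory.HarrisKudlaSweet1996.GlobalSplittingCharacters                -- ★ `quadraticHeckeCharCM`
import HarnessLib

/-!
# Crux `HLiu418`, socket #41, KIND 1 ∕ organ (K1b-W), file (KW1-g) — `K2LiuKindOneLineGoodPlaceLetters`: THE PER-GOOD-PLACE RESIDUAL LETTERS OF THE ORGAN, PACKAGED COFINITELY —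
# off ONE finite set `U₁ ⊇ T₀` of places of `L⁺`: `χ` unramified above `v`, `|2|_w = 1`, `|δ|_w = 1`, the parity letter `∏_{w∣v} χ_w(ι_w ϖ) = ε_{L∕L⁺}(ϖ_v)` for EVERY uniformizer `ϖ`,
# and the volume normalisation `ν_v(N_Δ(L⁺_v) ∩ K_{H,v}) = 1` read in the (KW1-b2) currency

Cell `hodgecm-mathlib`, crux item hLiu418 = `stmt-HodgeConjecture-24832` (helper lane `--supports … --as helper`, count-neutral), route of record `HCCMUnconditional`;
squad K2 ∕ K2Liu, road `K2_Liu`, socket #41 `sig_K2LiuSiegelEisensteinContinuation`, KIND 1, organ (K1b-W) (line lead K2Liu-p14 (g4)).  ★ (KW1-b) p862675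
`K2LiuKindOneLineWhittakerEuler.whittakerDelta_eq_kindWPart_mul_line` takes the rank-one good-place letter `hJ₁` BY VALUE at every place `v ∉ U(μ, g)`; (KW1-b2)
`K2LiuKindOneLineGoodPlaceFactor.integral_conj_unipDeltaChar_mul_lambdaLoc_weylDelta_eq` (line lead, HOME `K2/K2Liu-p14/g4/…` :270–295) PAYS it at a place `v` modulo, BY VALUE
and PER PLACE: the volume normalisation `hvol : ν.real {u | ↑u ∈ K_{H,v}} = 1`, unramifiedness `hχ : ∀ w ∣ v, χ.IsUnramifiedAt w`, the good-place letters
`h2 : ∀ w ∣ v, valuation_{L_w} 2 = 1` and `hδw : ∀ w ∣ v, |δ|_w = 1` (`δ = imagUnit L`), a uniformizer `ϖ` (`hϖ`, `hϖ0`), the PARITY letter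
`hα : ∏_{w∣v} χ_w(Units.mk0 (ι_w ϖ) _) = ε_{L∕L⁺}.valueAtUniformizer v`, and the coordinate reading `hread` ((KW1-b2′), LH7-p06).  THIS FILE packages the first five
COFINITELY, in those binder bytes, for the (K1b-♮) assembly `K2LiuKindOneLineTermPackage` (LH4-p14 (g7)) and the (KW1-f) STAGE 2 package:
* §1 **COFINITE UNIT LETTERS** — `exists_finset_forall_valued_eq_one`: a non-zero `x ∈ L` is a `w`-adic UNIT (`Valued.v (x : L_w) = 1`) at every `w ∣ v` for `v` off a finite
  set of places of `L⁺` (★ (d1) `exists_finset_forall_integral` for the 1×1 matrices `(x)` and `(x⁻¹)`); hence `exists_finset_forall_valuation_two_eq_one` (`|2|_w = 1` in the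
  `ValuativeRel.valuation` spelling of (KW1-b2), ★ `valuation_eq_one_iff_valued`) and `exists_finset_forall_valued_imagUnit_eq_one` (`|δ|_w = 1`, ★ `imagUnit_ne_zero`).
* §2 **THE PARITY LETTER FOR EVERY UNIFORMIZER** — `prod_localComponent_mk0_toPlace_eq_valueAtUniformizer`: for `χ` with `χ ∘ (base change) = ε` (hypothesis-first, the
  conjugate-symplectic restriction letter `χ|_{𝕀_{L⁺}} = ε_{L∕L⁺}` of the TOP's `toHeckeCharacter L lam⁻¹`) and `χ` unramified above `v`:
  `∏_{w∣v} χ_w(Units.mk0 (ι_w ϖ) _) = ε.valueAtUniformizer v` for EVERY uniformizer `ϖ` of `L⁺_v` — ★ J1a-dict `valueAtUniformizer_eq_prod_of_comp_ideleBaseChange` read through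
  ★ `IsUnramifiedAt.localComponent_eq_one_of_valuation_eq_one` + ★ `valuation_eq_one_iff_valued` (= ★ (KW1-b2)'s `localComponent_eq_one_of_valued_eq_one`).  `toPlace_unifAt_ne_zero` supplies
  the uniformizer `unifAt L⁺ v` (★ `valued_unifAt`) with `ι_w ϖ ≠ 0`.
* §3 **THE VOLUME LETTER** — `measureReal_localInt_eq_one_of_hνK`: ★ (KW1-b)'s normalisation `hνK : ν_v(↑(inH K N_Δ v)) = 1` IS (KW1-b2)'s `hvol : ν_v.real {u | ↑u ∈ K_{H,v}} = 1`
  (`inH K N v = (K v).subgroupOf (N v)`, definitional).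
* §4 **HEAD `exists_cofinite_goodPlaceLetters`** — for the doubled LINE datum `(e : Fin N × Fin M ≃ Fin 1, dV, dW)`, a bad set `T₀` off which `χ` is unramified (★ (KW1-b)'s `hχ`),
  the restriction letter `hε`, and a local Haar family `νv` with `hνK`: `∃ U₁ ⊇ T₀` finite with, for every `v ∉ U₁`, the five letters
  `hχ v ∧ h2 v ∧ hδw v ∧ (∀ ϖ hϖ hϖ0, hα v ϖ) ∧ hvol v` in (KW1-b2)'s binder bytes.
[CasselsFrohlichANT1967, Ch. XV (Tate) §3.1] [TateThesis1967, §4.3] [NeukirchANT1999, Ch. VII §6 (6.12)] [Casselman1980, §3 Thm. 3.1] [HarrisKudlaSweet1996, §6 (6.16)].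
HONEST LABEL.  Count-neutral helper, closes no socket; `hε` enters BY VALUE: `HC_CM` is proved only modulo the 7 printed citations (2 remaining named inputs:
hLiu418 = `stmt-HodgeConjecture-24832`, h413 = `stmt-HodgeConjecture-24833`) until rung 0 closes.

## References
* [CasselsFrohlichANT1967] J. W. S. Cassels, A. Fröhlich (eds.), *Algebraic Number Theory* (1967): Ch. XV (Tate), §3.1 (`x ∈ K` is a `v`-unit for almost all `v`); Ch. II §10.
* [TateThesis1967] J. Tate, *Fourier analysis in number fields and Hecke's zeta-functions* (1950∕1967): §4.3 (local components of a Hecke character, `χ_v(ϖ_v)`).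
* [NeukirchANT1999] J. Neukirch, *Algebraic Number Theory* (1999): Ch. VII §6 (6.12) (restriction of idele class characters along a base change).
* [Casselman1980] W. Casselman, *The unramified principal series of p-adic groups I*, Compositio Math. 40 (1980): §3 Thm. 3.1.
* [HarrisKudlaSweet1996] M. Harris, S. Kudla, W. J. Sweet, J. AMS 9 (1996): §6 (6.16) (`χ|_{𝔸_F^×} = ε_{E∕F}`, the parity of the local parameter).
-/

set_option autoImplicit false
set_option linter.dupNamespace false -- the mandated namespace repeats `HodgeConjecture.HodgeConjecture`

noncomputable section

open scoped ValuativeRel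
open NumberField IsDedekindDomain MeasureTheory
open Literature.NumberTheory.Automorphic Literature.NumberTheory.Automorphic.UnitaryGroup Literature.NumberTheory.GaloisRepresentations
open Literature.NumberTheory.GelbartRogawski1991 Literature.NumberTheory.GelbartRogawski1991.GRConstruction
open Literature.NumberTheory.GelbartRogawski1991.UnitaryDualPair
open Literature.NumberTheory.K2Lit.SiegelDoubled
open Literature.Topology.Algebra.RestrictedProduct (inH)
open Summit.HodgeConjecture.HodgeConjecture.Cruxes.HLiu418.K2LiuSiegelUnipotentLocalDefs
open Summit.HodgeConjecture.HodgeConjecture.Cruxes.HLiu418.K2LiuSiegelUnipotentSplitDefs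
open Summit.HodgeConjecture.HodgeConjecture.Cruxes.HLiu418.K2LiuSiegelUnipotentCharacterFactorisation (exists_finset_forall_integral)
open Summit.HodgeConjecture.HodgeConjecture.Cruxes.HLiu418.K2LiuLocalLFactorDefs (unifAt valued_unifAt unifAt_ne_zero)
open Summit.HodgeConjecture.HodgeConjecture.Cruxes.H413.K2E1HeckeCharBaseChangeLocalComponentsU (valueAtUniformizer_eq_prod_of_comp_ideleBaseChange)

namespace Summit.HodgeConjecture.HodgeConjecture.Cruxes.HLiu418.K2LiuKindOneLineGoodPlaceLetters

variable (L : Type) [Field L] [NumberField L] [IsCMField L]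

/-! ## §1 Cofinite unit letters: a non-zero `x ∈ L` is a `w`-adic unit above almost every place of `L⁺` -/

section Units

omit [IsCMField L] in
/-- an element of `L` which is a `w`-adic integer together with its inverse is a `w`-adic UNIT: `Valued.v (x : L_w) = 1`. [cite: CasselsFrohlichANT1967, Ch. XV §3.1] -/
theorem valued_eq_one_of_mem_integers_of_inv_mem {x : L} (hx : x ≠ 0) (w : HeightOneSpectrum (𝓞 L))
    (h₁ : ((x : L) : w.adicCompletion L) ∈ w.adicCompletionIntegers L) (h₂ : ((x⁻¹ : L) : w.adicCompletion L) ∈ w.adicCompletionIntegers L) :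
    Valued.v ((x : L) : w.adicCompletion L) = 1 := by
  rw [HeightOneSpectrum.mem_adicCompletionIntegers] at h₁ h₂
  have hx' : ((x : L) : w.adicCompletion L) ≠ 0 := by
    rw [ne_eq, ← map_zero (algebraMap L (w.adicCompletion L))]
    exact fun h => hx ((algebraMap L (w.adicCompletion L)).injective h)
  have hinv : ((x⁻¹ : L) : w.adicCompletion L) = (((x : L) : w.adicCompletion L))⁻¹ := map_inv₀ (algebraMap L (w.adicCompletion L)) x
  rw [hinv, map_inv₀] at h₂
  have hpos : 0 < Valued.v ((x : L) : w.adicCompletion L) := zero_lt_iff.2 ((Valuation.ne_zero_iff _).2 hx')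
  have hge : 1 ≤ Valued.v ((x : L) : w.adicCompletion L) := by
    by_contra hlt
    rw [not_le] at hlt
    have : 1 < (Valued.v ((x : L) : w.adicCompletion L))⁻¹ := one_lt_inv_iff₀.2 ⟨hpos, hlt⟩
    exact absurd h₂ (not_le.2 this)
  exact le_antisymm h₁ hge

omit [IsCMField L] in
/-- **A NON-ZERO `x ∈ L` IS A UNIT ABOVE ALMOST EVERY PLACE OF `L⁺`**: there is a finite set `T` of places of `L⁺ = Fp L` such that `Valued.v (x : L_w) = 1` for every `v ∉ T` and every
place `w` of `L` above `v` (★ (d1) `exists_finset_forall_integral` for the 1×1 matrices `(x)` and `(x⁻¹)`). [cite: CasselsFrohlichANT1967, Ch. XV (Tate) §3.1] -/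
theorem exists_finset_forall_valued_eq_one {x : L} (hx : x ≠ 0) :
    ∃ T : Finset (HeightOneSpectrum (𝓞 (Fp L))), ∀ v, v ∉ T → ∀ w : UnitaryGroup.PlacesOver L v, Valued.v ((x : L) : w.1.adicCompletion L) = 1 := by
  classical
  obtain ⟨T₁, hT₁⟩ := exists_finset_forall_integral L (Matrix.of fun _ _ : Fin 1 => x)
  obtain ⟨T₂, hT₂⟩ := exists_finset_forall_integral L (Matrix.of fun _ _ : Fin 1 => x⁻¹)
  refine ⟨T₁ ∪ T₂, fun v hv w => ?_⟩
  rw [Finset.mem_union, not_or] at hv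
  exact valued_eq_one_of_mem_integers_of_inv_mem L hx w.1 (by simpa using hT₁ v hv.1 w 0 0) (by simpa using hT₂ v hv.2 w 0 0)

omit [IsCMField L] in
/-- **`|2|_w = 1` ABOVE ALMOST EVERY PLACE OF `L⁺`**, in the `ValuativeRel.valuation` spelling of (KW1-b2)'s `h2` (★ `valuation_eq_one_iff_valued`).
[cite: CasselsFrohlichANT1967, Ch. XV (Tate) §3.1] -/
theorem exists_finset_forall_valuation_two_eq_one :
    ∃ T : Finset (HeightOneSpectrum (𝓞 (Fp L))), ∀ v, v ∉ T → ∀ w : UnitaryGroup.PlacesOver L v,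
      ValuativeRel.valuation (w.1.adicCompletion L) (2 : w.1.adicCompletion L) = 1 := by
  obtain ⟨T, hT⟩ := exists_finset_forall_valued_eq_one L (x := (2 : L)) two_ne_zero
  refine ⟨T, fun v hv w => (LocalSplitting.valuation_eq_one_iff_valued L w.1 _).2 ?_⟩
  have h2 : ((2 : L) : w.1.adicCompletion L) = 2 := map_ofNat (algebraMap L (w.1.adicCompletion L)) 2
  have h := hT v hv w
  rwa [h2] at h

/-- **`|δ|_w = 1` ABOVE ALMOST EVERY PLACE OF `L⁺`** for the CM datum's `δ = imagUnit L` (★ `imagUnit_ne_zero`) — (KW1-b2)'s `hδw`. [cite: CasselsFrohlichANT1967, Ch. XV (Tate) §3.1] -/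
theorem exists_finset_forall_valued_imagUnit_eq_one :
    ∃ T : Finset (HeightOneSpectrum (𝓞 (Fp L))), ∀ v, v ∉ T → ∀ w : UnitaryGroup.PlacesOver L v,
      Valued.v ((imagUnit L : L) : w.1.adicCompletion L) = 1 :=
  exists_finset_forall_valued_eq_one L (imagUnit_ne_zero L)

end Units

/-! ## §2 The parity letter for every uniformizer, and the uniformizer supply -/

section Parity

variable (v : HeightOneSpectrum (𝓞 (Fp L)))

omit [IsCMField L] in
/-- **THE PARITY LETTER FOR EVERY UNIFORMIZER.**  `χ` a Hecke character of `L`, `ε` one of `L⁺` with `χ ∘ (base change) = ε` (hypothesis-first restriction letter), `χ` unramified at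
every `w ∣ v`; then for EVERY uniformizer `ϖ` of `L⁺_v` (`|ϖ|_v = exp(−1)`, `ι_w ϖ ≠ 0`): `∏_{w∣v} χ_w(Units.mk0 (ι_w ϖ) _) = ε.valueAtUniformizer v` — (KW1-b2)'s `hα` at `ε := ε_{L∕L⁺}`
(★ J1a-dict `valueAtUniformizer_eq_prod_of_comp_ideleBaseChange`; unramified ⇒ unit-trivial by ★ `IsUnramifiedAt.localComponent_eq_one_of_valuation_eq_one` + ★
`valuation_eq_one_iff_valued`, as ★ (KW1-b2)'s `localComponent_eq_one_of_valued_eq_one`). [cite: NeukirchANT1999, Ch. VII §6 (6.12)] [cite: TateThesis1967, §4.3] [cite: HarrisKudlaSweet1996, §6 (6.16)] -/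
theorem prod_localComponent_mk0_toPlace_eq_valueAtUniformizer (χ : HeckeCharacter L) (ε : HeckeCharacter (Fp L))
    (hε : ∀ a : ideleGroup (Fp L), χ (AdeleRing.ideleBaseChange (Fp L) L a) = ε a)
    (hχ : ∀ w : UnitaryGroup.PlacesOver L v, χ.IsUnramifiedAt w.1)
    {ϖ : v.adicCompletion (Fp L)} (hϖ : Valued.v ϖ = WithZero.exp (-1 : ℤ)) (hϖ0 : ∀ w : UnitaryGroup.PlacesOver L v, toPlace v w ϖ ≠ 0) :
    (((∏ w : UnitaryGroup.PlacesOver L v, χ.localComponent w.1 (Units.mk0 (toPlace v w ϖ) (hϖ0 w))) : ℂˣ) : ℂ) = ε.valueAtUniformizer v :=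
  (valueAtUniformizer_eq_prod_of_comp_ideleBaseChange χ ε hε v
    (fun w u hu => (hχ w).localComponent_eq_one_of_valuation_eq_one ((LocalSplitting.valuation_eq_one_iff_valued L w.1 (u : w.1.adicCompletion L)).2 hu))
    hϖ hϖ0).symm

omit [IsCMField L] in
/-- **THE UNIFORMIZER SUPPLY**: `ι_w (unifAt L⁺ v) ≠ 0` at every `w ∣ v` (★ `unifAt_ne_zero`; `ι_w` is a ring map of fields), so `ϖ := unifAt L⁺ v` (★ `valued_unifAt`) serves
(KW1-b2)'s `(hϖ, hϖ0)`. [cite: Casselman1980, §3] -/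
theorem toPlace_unifAt_ne_zero (w : UnitaryGroup.PlacesOver L v) : toPlace v w (unifAt (Fp L) v) ≠ 0 :=
  (map_ne_zero (toPlace v w)).2 (unifAt_ne_zero (Fp L) v)

end Parity

/-! ## §3 The volume letter: (KW1-b)'s `hνK` IS (KW1-b2)'s `hvol` -/

section Volume

variable {N M n : ℕ} (e : Fin N × Fin M ≃ Fin n)
  (dV : Fin N → L) (hdV : ∀ i, IsCMField.complexConj L (dV i) = dV i)
  (dW : Fin M → L) (hdW : ∀ i, IsCMField.complexConj L (dW i) = dW i)
  (v : HeightOneSpectrum (𝓞 (Fp L))) [MeasurableSpace ↥(unipDeltaLoc L e dV hdV dW hdW v)]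

/-- **THE VOLUME LETTER.**  ★ (KW1-b)'s normalisation of the local Haar measure on the hyperspecial part of `N_Δ(L⁺_v)`, `ν_v(↑(inH K N_Δ v)) = 1` (`inH K N v = (K v).subgroupOf (N v)`),
read in (KW1-b2)'s currency: `ν_v.real {u | ↑u ∈ K_{H,v}} = 1` (generic `n`; the LINE reads `n := 1`). [cite: Casselman1980, §3 Thm. 3.1] -/
theorem measureReal_localInt_eq_one_of_hνK (ν : Measure ↥(unipDeltaLoc L e dV hdV dW hdW v))
    (hνK : ν (((inH (fun v => UnitaryGroup.localInt L (IsCMField.complexConj L) (n + n) (hermD L e dV hdV dW hdW) v)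
      (fun v => unipDeltaLoc L e dV hdV dW hdW v) v) : Subgroup ↥(unipDeltaLoc L e dV hdV dW hdW v)) : Set ↥(unipDeltaLoc L e dV hdV dW hdW v)) = 1) :
    ν.real {u : ↥(unipDeltaLoc L e dV hdV dW hdW v) | (u : UnitaryGroup.localPi L (IsCMField.complexConj L) (n + n) (hermD L e dV hdV dW hdW) v) ∈
      UnitaryGroup.localInt L (IsCMField.complexConj L) (n + n) (hermD L e dV hdV dW hdW) v} = 1 := by
  have hset : {u : ↥(unipDeltaLoc L e dV hdV dW hdW v) | (u : UnitaryGroup.localPi L (IsCMField.complexConj L) (n + n) (hermD L e dV hdV dW hdW) v) ∈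
      UnitaryGroup.localInt L (IsCMField.complexConj L) (n + n) (hermD L e dV hdV dW hdW) v} =
      (((inH (fun v => UnitaryGroup.localInt L (IsCMField.complexConj L) (n + n) (hermD L e dV hdV dW hdW) v)
        (fun v => unipDeltaLoc L e dV hdV dW hdW v) v) : Subgroup ↥(unipDeltaLoc L e dV hdV dW hdW v)) : Set ↥(unipDeltaLoc L e dV hdV dW hdW v)) := by
    ext u
    simp only [Set.mem_setOf_eq, SetLike.mem_coe, Subgroup.mem_subgroupOf]
  rw [measureReal_def, hset, hνK, ENNReal.toReal_one]

end Volume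

/-! ## §4 HEAD: the per-good-place residual letters of the (K1b-W) organ, cofinitely -/

section Head

variable {N M : ℕ} (e : Fin N × Fin M ≃ Fin 1)
  (dV : Fin N → L) (hdV : ∀ i, IsCMField.complexConj L (dV i) = dV i)
  (dW : Fin M → L) (hdW : ∀ i, IsCMField.complexConj L (dW i) = dW i)

/-- **THE PER-GOOD-PLACE RESIDUAL LETTERS, PACKAGED COFINITELY.**  Doubled LINE datum `(e : Fin N × Fin M ≃ Fin 1, dV, dW)` of the K2Lit CM frame; a Hecke character `χ` of `L`
unramified above every `v ∉ T₀` (★ (KW1-b)'s `hχ`) whose restriction to `𝕀_{L⁺}` is `ε_{L∕L⁺} = quadraticHeckeCharCM L` (`hε`, by value — the conjugate-symplectic letter of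
the TOP's `toHeckeCharacter L lam⁻¹`); a local Haar family `νv` on the `N_Δ(L⁺_v)` normalised by ★ (KW1-b)'s `hνK`.  THEN there is ONE finite set `U₁ ⊇ T₀` of places of `L⁺`
off which, at every `v`, the five by-value letters of (KW1-b2) `integral_conj_unipDeltaChar_mul_lambdaLoc_weylDelta_eq` hold in its binder bytes: `hχ` (unramified above `v`),
`h2` (`valuation_{L_w} 2 = 1`), `hδw` (`|imagUnit L|_w = 1`), `hα` for EVERY uniformizer `ϖ` (`∏_{w∣v} χ_w(Units.mk0 (ι_w ϖ) _) = ε_{L∕L⁺}.valueAtUniformizer v`), and `hvol`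
(`ν_v.real {u | ↑u ∈ K_{H,v}} = 1`).  §1 + §2 + §3. [cite: CasselsFrohlichANT1967, Ch. XV (Tate) §3.1] [cite: TateThesis1967, §4.3] [cite: HarrisKudlaSweet1996, §6 (6.16)] [cite: Casselman1980, §3 Thm. 3.1] -/
theorem exists_cofinite_goodPlaceLetters (T₀ : Finset (HeightOneSpectrum (𝓞 (Fp L)))) {χ : HeckeCharacter L}
    (hχ : ∀ v, v ∉ T₀ → ∀ w : UnitaryGroup.PlacesOver L v, χ.IsUnramifiedAt w.1)
    (hε : ∀ a : ideleGroup (Fp L), χ (AdeleRing.ideleBaseChange (Fp L) L a) = quadraticHeckeCharCM L a)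
    [∀ v : HeightOneSpectrum (𝓞 (Fp L)), MeasurableSpace ↥(unipDeltaLoc L e dV hdV dW hdW v)]
    (νv : ∀ v : HeightOneSpectrum (𝓞 (Fp L)), Measure ↥(unipDeltaLoc L e dV hdV dW hdW v))
    (hνK : ∀ v, νv v (((inH (fun v => UnitaryGroup.localInt L (IsCMField.complexConj L) (1 + 1) (hermD L e dV hdV dW hdW) v)
      (fun v => unipDeltaLoc L e dV hdV dW hdW v) v) : Subgroup ↥(unipDeltaLoc L e dV hdV dW hdW v)) : Set ↥(unipDeltaLoc L e dV hdV dW hdW v)) = 1) :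
    ∃ U₁ : Finset (HeightOneSpectrum (𝓞 (Fp L))), T₀ ⊆ U₁ ∧ ∀ v, v ∉ U₁ →
      (∀ w : UnitaryGroup.PlacesOver L v, χ.IsUnramifiedAt w.1) ∧
      (∀ w : UnitaryGroup.PlacesOver L v, ValuativeRel.valuation (w.1.adicCompletion L) (2 : w.1.adicCompletion L) = 1) ∧
      (∀ w : UnitaryGroup.PlacesOver L v, Valued.v ((imagUnit L : L) : w.1.adicCompletion L) = 1) ∧
      (∀ {ϖ : v.adicCompletion (Fp L)} (_hϖ : Valued.v ϖ = WithZero.exp (-1 : ℤ)) (hϖ0 : ∀ w : UnitaryGroup.PlacesOver L v, toPlace v w ϖ ≠ 0),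
        (((∏ w : UnitaryGroup.PlacesOver L v, χ.localComponent w.1 (Units.mk0 (toPlace v w ϖ) (hϖ0 w))) : ℂˣ) : ℂ) =
          (quadraticHeckeCharCM L).valueAtUniformizer v) ∧
      (νv v).real {u : ↥(unipDeltaLoc L e dV hdV dW hdW v) | (u : UnitaryGroup.localPi L (IsCMField.complexConj L) (1 + 1) (hermD L e dV hdV dW hdW) v) ∈
        UnitaryGroup.localInt L (IsCMField.complexConj L) (1 + 1) (hermD L e dV hdV dW hdW) v} = 1 := by
  classical
  obtain ⟨T₂, hT₂⟩ := exists_finset_forall_valuation_two_eq_one L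
  obtain ⟨Tδ, hTδ⟩ := exists_finset_forall_valued_imagUnit_eq_one L
  refine ⟨T₀ ∪ T₂ ∪ Tδ, Finset.subset_union_left.trans Finset.subset_union_left, fun v hv => ?_⟩
  simp only [Finset.mem_union, not_or] at hv
  obtain ⟨⟨hv₀, hv₂⟩, hvδ⟩ := hv
  exact ⟨hχ v hv₀, hT₂ v hv₂, hTδ v hvδ,
    fun hϖ hϖ0 => prod_localComponent_mk0_toPlace_eq_valueAtUniformizer L v χ (quadraticHeckeCharCM L) hε (hχ v hv₀) hϖ hϖ0,
    measureReal_localInt_eq_one_of_hνK L e dV hdV dW hdW v (νv v) (hνK v)⟩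

end Head

end Summit.HodgeConjecture.HodgeConjecture.Cruxes.HLiu418.K2LiuKindOneLineGoodPlaceLetters

end
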